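import Literature.Algebra.Lie.HyperbolicPlaneGradedPieces
import Literature.Algebra.Lie.RealOrthogonalAlgebraSemisimple
import Literature.Algebra.Lie.OrthogonalAlgebraSemisimple
import HarnessLib

/-!
# Looijenga–Lunts (2.9), orthogonal cases, over ANY field of characteristic `0` and over `ℝ`: a hyperbolic pair grades `𝔰𝔬(V, B)` into a Jordan–Lefschetz pair — the real forms `(𝔰𝔬(p, q), h)`

Topic `Literature/Algebra/Lie` (namespace `Literature.Algebra.Lie.HyperbolicPlaneGrading`, continued).  Lane `lit-hodgefound`
(Track 2 foundations library), skeleton seat `lit-hodgefound-skel-1` (generation 52), row **A1-216** of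
`run/shared/lean/pub/lit-hodgefound/SKELETON.md`.  Row A1-203 (`HyperbolicPlaneJordanLefschetzPair`) proved that a
hyperbolic pair `e, f` (`B(e,e) = B(f,f) = 0`, `B(e,f) = 1`) in a non-degenerate quadratic space `(V, B)` grades
`𝔰𝔬(V, B)` into a Jordan–Lefschetz pair by `h = h_{e,f}`, `h v = 2(B(v,f) e - B(v,e) f)` — but only over an
ALGEBRAICALLY CLOSED field (the proof transported the split matrix gradings, which needs an adapted basis of `V_0`);
row A1-208 (`HyperbolicPlaneGradedPieces`) described the graded pieces positionally over any field.  Looijenga–Lunts use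
the statement for REAL forms of every signature: §4 (4.5) "(𝔤_tot(X;ℝ), h) is of Jordan–Lefschetz type of type (B,B) or
(D,D) with 𝔤_tot(X;ℝ) isomorphic to 𝔰𝔬(4, b_2(X)−2)" (hyperkähler manifolds; for a K3 surface `H² ≅ U³ ⊕ E_8(-1)²`
carries hyperbolic pairs).  This file removes the algebraic closure: with row A1-214's semisimplicity of the real
`𝔰𝔬(p, q)` (`isSemisimple_skewAdjoint`) it proves

* **`isJordanLefschetzPair_hyperbolicGrading_real`: `(𝔰𝔬(V, B), h_{e,f})` is a Jordan–Lefschetz pair over `ℝ`** for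
  every non-degenerate symmetric REAL `B` (any signature) with a hyperbolic pair and `dim V ≥ 3`
  (`isLefschetzPair_hyperbolicGrading_real`, `exists_isJordanLefschetzPair_real`),

through the field-agnostic **`isJordanLefschetzPair_hyperbolicGrading_of_isSemisimple`** (any field of characteristic
`0`, semisimplicity of `𝔰𝔬(V, B)` as a hypothesis — discharged over `ℝ` by row A1-214, over an algebraically closed
field by row A1-187), whose three ingredients are proved basis-free, with the rotations
`r_{p,q} = B(q, ·)p - B(p, ·)q` (`soElem`) as the only device:

* §12 `𝔤_2` is ABELIAN (`lie_eq_zero_of_mem_adDegree_two_hyperbolic`, from row A1-208's positional description), and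
  every anisotropic `u ∈ V_0` (`B(u,u) ≠ 0`) carries the `𝔰𝔩₂`-TRIPLE `(E_u, h, F_u)`, `E_u = r_{u,e} ∈ 𝔤_2`,
  `F_u = -(2/B(u,u)) r_{u,f} ∈ 𝔤_{-2}` (`isSl2Triple_soElem`; the bracket `[E_u, F_{u'}] = r_{u',u} - ½B(u,u')h`,
  `soElem_e_mul_soElem_f_sub`);
* §13 `V_0` has anisotropic vectors when `dim V ≥ 3` (`exists_anisotropic`), and an isotropic `w` is a difference of
  anisotropic ones (`exists_add_smul_anisotropic`);
* §14 GENERATION (`lieSpan_adDegree_two_union_lefschetzDuals_eq_top`): the Lie subalgebra generated by `𝔤_2` and the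
  `F_u` contains `h`, all `r_{u,e}`, all `r_{u,f}` (`u ∈ V_0`), the rotations `r_{u',u}` of `V_0` and `r_{e,f} = ½h`,
  hence by bilinearity every `r_{p,q}`, and `𝔰𝔬(V, B)` is spanned by rotations (`T = ½ Σᵢ r_{Tbᵢ, bᵢ^∨}`, the tree's
  `eq_smul_sum_soElem`).

THEOREMS ONLY (no definition, no named fact, no `sorry`; net debt `0`); no local instance attribute (the ambient
`𝔤𝔩(V)` bracket is supplied by `letI` inside two proofs, as in row A1-207).  Hypotheses style of rows A1-203/208:
`h` is any `x ∈ 𝔰𝔬(V, B)` with `x = h_{e,f}` as an endomorphism, `V_0` any `W` with `w ∈ W ↔ B(w,e) = B(w,f) = 0`.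

## Source, VERBATIM

E. Looijenga, V. A. Lunts, *A Lie algebra attached to a projective variety*, Invent. Math. **129** (1997) 361–412 (held
TeX `paper:arxiv-alg-geom_9604014`), §2 (2.9) p. 10 L94–L103: "Case `(B_m, B_{m-1})` or `(D_m, D_{m-1})`:
`(𝔰𝔬(n), 𝔰𝔬(n-2))` with `n = 2m+1 ≥ 5` resp. `n = 2m ≥ 10`.  Let `V` be a vector space of dimension `n` equipped
with a nondegenerate symmetric bilinear form.  Choose isotropic lines `V_{±2}` such that `V_{-2} ⊕ V_2` is
nondegenerate […] Let `V_0` be the orthogonal complement of `V_{-2} ⊕ V_2` in `V` and let `h ∈ 𝔰𝔬(V)` be the element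
with the eigen space decomposition `V_{-2} ⊕ V_0 ⊕ V_2`.  Then `𝔤_0 = 𝔰𝔬(V_0) × 𝔤𝔩(V_2)` and `𝔤_{±2}` projects
isomorphically to `Hom(V_0, V_{±2})`"; (2.6) p. 10 L20–L29 (the list, "(B_m, B_{m−1}) (m ≥ 2) … (D_m, D_{m−1}) (m ≥ 5)");
§1 p. 7 L54–L78 (Lefschetz triples: "(i) … for `e` in the domain of `f`, we have an `𝔰𝔩(2)`-triple `(e, h, f_e)` and
(ii) `𝔤` is as a Lie algebra generated by `𝔞` and the image of `f`"); §2 (2.1)–(2.2) p. 9 L83–L116; §4 (4.5) p. 19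
L23–L26: "(i) The pair `(𝔤_tot(X;ℝ), h)` is of Jordan–Lefschetz type of type `(B,B)` or `(D,D)` with `𝔤_tot(X;ℝ)`
isomorphic to `𝔰𝔬(4, b_2(X)−2)`."

## Contents (all proved)

* §11 `soElem_e_apply`, `soElem_f_apply`, `soElem_eq_half_smul` (`r_{e,f} = ½h`) (+ private `soElem_self`);
* §12 `soElem_e_mem_adDegree_two`, `smul_soElem_f_mem_adDegree_neg_two`, **`soElem_e_mul_soElem_f_sub`**,
  **`isSl2Triple_soElem`**, **`lie_eq_zero_of_mem_adDegree_two_hyperbolic`**;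
* §13 `exists_anisotropic` (+ private `exists_add_smul_anisotropic`);
* §14 **`lieSpan_adDegree_two_union_lefschetzDuals_eq_top`**;
* §15 **`isJordanLefschetzPair_hyperbolicGrading_of_isSemisimple`**, `…_of_finrank`,
  **`isJordanLefschetzPair_hyperbolicGrading_real`**, `isLefschetzPair_hyperbolicGrading_real`, `exists_isJordanLefschetzPair_real`;
* §16 (rider, row A1-224, generation 53) **`isJordanLefschetzPair_hyperbolicGrading_of_charZero`**,
  `isLefschetzPair_hyperbolicGrading_of_charZero`, `exists_isJordanLefschetzPair_of_charZero` — the UNCONDITIONAL statement over EVERY field of characteristic `0` (e.g. `ℚ`):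
  the semisimplicity hypothesis of §15 is discharged by row A1-223 (`OrthogonalAlgebraSemisimple.isSemisimple`,
  Bourbaki *Lie* I §6 no. 7 Prop. 9), so `(𝔰𝔬(V, B), h_{e,f})` is a Jordan–Lefschetz pair for every non-degenerate
  symmetric `B` with a hyperbolic pair and `dim V ≥ 3` over any such field — the real theorems of §15 become the case
  `K = ℝ`.

## SCOPE (what is NOT formalised here)

(a) Which real forms occur for hyperkähler manifolds ((4.5): `𝔰𝔬(4, b_2 − 2)`, the BBF form) is prover seat p06's
topic; nothing geometric is stated here.  (b) Positive characteristic is excluded (`CharZero`), as in rows A1-203/208.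
(c) The graded pieces (row A1-208) and the algebraically closed case (row A1-203) are used or cited, not restated.

## References

* [LooijengaLunts1997] E. Looijenga, V. A. Lunts, *A Lie algebra attached to a projective variety*, Invent. Math. 129
  (1997) 361–412; arXiv:alg-geom/9604014. §1 p. 7; §2 (2.1)–(2.2) p. 9, (2.6), (2.9) p. 10; §4 (4.5) p. 19.
-/

namespace Literature.Algebra.Lie.HyperbolicPlaneGrading

open Module Function Set Literature.Algebra.Lie Literature.LinearAlgebra.Alternating

variable {K : Type*} [Field K] {V : Type*} [AddCommGroup V] [Module K V] {B : LinearMap.BilinForm K V}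

/-! ### §11 The rotations `r_{u,e} = E_u`, `r_{u,f} = F_u` and `r_{e,f} = ½h` -/

section Rotations

variable {e f : V}

/-- Values of the rotation `r_{u,e} : w ↦ B(e,w)u - B(u,w)e` for `u ⊥ e, f`: `r_{u,e} e = 0`, `r_{u,e} f = u`,
`r_{u,e} w = -B(u,w) e` on `V_0`. [cite: LooijengaLunts1997, §2 (2.9) p. 10 L101–L103] -/
theorem soElem_e_apply (hs : ∀ u v : V, B u v = B v u) (he : B e e = 0) (hef : B e f = 1) {u : V} (hue : B u e = 0)
    (huf : B u f = 0) :
    soElem B u e e = 0 ∧ soElem B u e f = u ∧ ∀ w, B w e = 0 → soElem B u e w = -(B u w • e) := by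
  refine ⟨?_, ?_, fun w hwe ↦ ?_⟩
  · rw [soElem_apply, he, hue, zero_smul, zero_smul, sub_zero]
  · rw [soElem_apply, hef, huf, one_smul, zero_smul, sub_zero]
  · rw [soElem_apply, hs e w, hwe, zero_smul, zero_sub]

/-- Values of `r_{u,f} : w ↦ B(f,w)u - B(u,w)f` for `u ⊥ e, f`: `r_{u,f} e = u`, `r_{u,f} f = 0`, `r_{u,f} w = -B(u,w) f`.
[cite: LooijengaLunts1997, §2 (2.9) p. 10 L101–L103] -/
theorem soElem_f_apply (hs : ∀ u v : V, B u v = B v u) (hf : B f f = 0) (hef : B e f = 1) {u : V} (hue : B u e = 0)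
    (huf : B u f = 0) :
    soElem B u f e = u ∧ soElem B u f f = 0 ∧ ∀ w, B w f = 0 → soElem B u f w = -(B u w • f) := by
  refine ⟨?_, ?_, fun w hwf ↦ ?_⟩
  · rw [soElem_apply, hs f e, hef, hue, one_smul, zero_smul, sub_zero]
  · rw [soElem_apply, hf, huf, zero_smul, zero_smul, sub_zero]
  · rw [soElem_apply, hs f w, hwf, zero_smul, zero_sub]

/-- `r_{u,u} = 0`. [folklore] -/
private theorem soElem_self (u : V) : soElem B u u = 0 :=
  LinearMap.ext fun w ↦ by rw [soElem_apply, sub_self, LinearMap.zero_apply]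

variable [CharZero K]

/-- `r_{e,f} = ½ h_{e,f}`. [cite: LooijengaLunts1997, §2 (2.9) p. 10 L94–L103] -/
theorem soElem_eq_half_smul (hs : ∀ u v : V, B u v = B v u) (x : Module.End K V)
    (hx : x = (2 : K) • ((B.flip f).smulRight e - (B.flip e).smulRight f)) : soElem B e f = (2 : K)⁻¹ • x := by
  refine LinearMap.ext fun w ↦ ?_
  rw [LinearMap.smul_apply, hx, hyperbolicGrading_apply, smul_smul, inv_mul_cancel₀ two_ne_zero, one_smul, soElem_apply,
    hs f w, hs e w]

end Rotations

/-! ### §12 The `𝔰𝔩₂`-triple `(E_u, h, F_u)` of an anisotropic `u ∈ V_0` and commutation of `𝔤_2` -/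

section Triple

variable [CharZero K] {e f : V} {W : Submodule K V}

omit [CharZero K] in
/-- `E_u = r_{u,e} ∈ 𝔤_2` for `u ∈ V_0`. [cite: LooijengaLunts1997, §2 (2.9) p. 10 L101–L103] -/
theorem soElem_e_mem_adDegree_two (hs : ∀ u v : V, B u v = B v u) (he : B e e = 0) (hf : B f f = 0) (hef : B e f = 1)
    (hW : ∀ w, w ∈ W ↔ B w e = 0 ∧ B w f = 0) (x : skewAdjointLieSubalgebra B)
    (hx : (x : Module.End K V) = (2 : K) • ((B.flip f).smulRight e - (B.flip e).smulRight f)) {u : V} (hu : u ∈ W) :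
    (⟨soElem B u e, soElem_mem_skewAdjointLieSubalgebra B (LinearMap.BilinForm.isSymm_def.2 hs) u e⟩ :
        skewAdjointLieSubalgebra B) ∈ adDegree K x 2 := by
  obtain ⟨hue, huf⟩ := (hW u).1 hu
  obtain ⟨h1, h2, h0⟩ := soElem_e_apply hs he hef hue huf
  refine mem_adDegree_two_of_apply hs he hf hef hW x hx _ h1 (by rw [h2]; exact hu) fun w hw ↦ ?_
  rw [h0 w ((hW w).1 hw).1]
  exact Submodule.neg_mem _ (Submodule.smul_mem _ _ (Submodule.mem_span_singleton_self e))

/-- `F_u = r_{u,f} ∈ 𝔤_{-2}` for `u ∈ V_0` (and so is any multiple). [cite: LooijengaLunts1997, §2 (2.9) p. 10 L101–L103] -/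
theorem smul_soElem_f_mem_adDegree_neg_two (hs : ∀ u v : V, B u v = B v u) (he : B e e = 0) (hf : B f f = 0)
    (hef : B e f = 1) (hW : ∀ w, w ∈ W ↔ B w e = 0 ∧ B w f = 0) (x : skewAdjointLieSubalgebra B)
    (hx : (x : Module.End K V) = (2 : K) • ((B.flip f).smulRight e - (B.flip e).smulRight f)) {u : V} (hu : u ∈ W)
    (c : K) :
    c • (⟨soElem B u f, soElem_mem_skewAdjointLieSubalgebra B (LinearMap.BilinForm.isSymm_def.2 hs) u f⟩ :
        skewAdjointLieSubalgebra B) ∈ adDegree K x (-2) := by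
  refine Submodule.smul_mem _ c ?_
  obtain ⟨hue, huf⟩ := (hW u).1 hu
  obtain ⟨h1, h2, h0⟩ := soElem_f_apply hs hf hef hue huf
  refine (mem_adDegree_neg_two_iff_apply hs he hf hef hW x hx _).2 ⟨h2, by rw [h1]; exact hu, fun w hw ↦ ?_⟩
  rw [h0 w ((hW w).1 hw).2]
  exact Submodule.neg_mem _ (Submodule.smul_mem _ _ (Submodule.mem_span_singleton_self f))

/-- **The bracket `[E_u, F_{u'}] = r_{u',u} - ½B(u,u') h`** for `u, u' ∈ V_0` (as endomorphisms of `V`).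
[cite: LooijengaLunts1997, §2 (2.9) p. 10 L101–L103 ("𝔤_0 = 𝔰𝔬(V_0) × 𝔤𝔩(V_2)")] -/
theorem soElem_e_mul_soElem_f_sub (hs : ∀ u v : V, B u v = B v u) (he : B e e = 0) (hf : B f f = 0) (hef : B e f = 1)
    (x : Module.End K V) (hx : x = (2 : K) • ((B.flip f).smulRight e - (B.flip e).smulRight f)) {u u' : V}
    (hue : B u e = 0) (huf : B u f = 0) (hu'e : B u' e = 0) (hu'f : B u' f = 0) :
    soElem B u e * soElem B u' f - soElem B u' f * soElem B u e = soElem B u' u - ((2 : K)⁻¹ * B u u') • x := by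
  obtain ⟨hEe, hEf, hE0⟩ := soElem_e_apply hs he hef hue huf
  obtain ⟨hFe, hFf, hF0⟩ := soElem_f_apply hs hf hef hu'e hu'f
  obtain ⟨hxe, hxf, hx0⟩ := hyperbolicGrading_apply_eq (K := K) hs he hf hef
  rw [← hx] at hxe hxf hx0
  have h2 : (2 : K)⁻¹ * B u u' * 2 = B u u' := by
    rw [mul_comm, ← mul_assoc, mul_inv_cancel₀ (two_ne_zero' K), one_mul]
  refine linearMap_eq_of_eq_on hs he hf hef _ _ ?_ ?_ fun w hwe hwf ↦ ?_
  · rw [LinearMap.sub_apply, Module.End.mul_apply, Module.End.mul_apply, hFe, hEe, map_zero, sub_zero, hE0 u' hu'e,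
      LinearMap.sub_apply, LinearMap.smul_apply, hxe, soElem_apply, hue, hu'e, zero_smul, zero_smul, sub_zero,
      zero_sub, smul_smul, h2]
  · rw [LinearMap.sub_apply, Module.End.mul_apply, Module.End.mul_apply, hFf, map_zero, hEf, zero_sub, hF0 u huf,
      neg_neg, LinearMap.sub_apply, LinearMap.smul_apply, hxf, soElem_apply, huf, hu'f, zero_smul, zero_smul,
      sub_zero, smul_neg, sub_neg_eq_add, zero_add, smul_smul, h2, hs u u']
  · rw [LinearMap.sub_apply, Module.End.mul_apply, Module.End.mul_apply, hF0 w hwf, hE0 w hwe, map_neg, map_neg,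
      map_smul, map_smul, hEf, hFe, LinearMap.sub_apply, LinearMap.smul_apply, hx0 w hwe hwf, smul_zero, sub_zero,
      soElem_apply, hs u w, hs u' w]
    abel

/-- **The `𝔰𝔩₂`-triple `(E_u, h, F_u)`**, `F_u = -(2/B(u,u)) r_{u,f}`, of an anisotropic `u ∈ V_0`: `[E_u, F_u] = h`.
[cite: LooijengaLunts1997, §2 (2.9) p. 10 L94–L103; §1 p. 7 L54–L66 ("for e in the domain of f, we have an 𝔰𝔩(2)-triple (e, h, f_e)")] -/
theorem isSl2Triple_soElem (hs : ∀ u v : V, B u v = B v u) (he : B e e = 0) (hf : B f f = 0) (hef : B e f = 1)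
    (hW : ∀ w, w ∈ W ↔ B w e = 0 ∧ B w f = 0) (x : skewAdjointLieSubalgebra B)
    (hx : (x : Module.End K V) = (2 : K) • ((B.flip f).smulRight e - (B.flip e).smulRight f)) {u : V} (hu : u ∈ W)
    (hq : B u u ≠ 0) :
    IsSl2Triple x
      (⟨soElem B u e, soElem_mem_skewAdjointLieSubalgebra B (LinearMap.BilinForm.isSymm_def.2 hs) u e⟩ :
        skewAdjointLieSubalgebra B)
      ((-(2 * (B u u)⁻¹)) • ⟨soElem B u f, soElem_mem_skewAdjointLieSubalgebra B (LinearMap.BilinForm.isSymm_def.2 hs) u f⟩) := by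
  obtain ⟨hue, huf⟩ := (hW u).1 hu
  have hE := mem_adDegree_iff.1 (soElem_e_mem_adDegree_two hs he hf hef hW x hx hu)
  have hF := mem_adDegree_iff.1 (smul_soElem_f_mem_adDegree_neg_two hs he hf hef hW x hx hu (-(2 * (B u u)⁻¹)))
  have he0 : e ≠ 0 := fun h ↦ by rw [h, LinearMap.BilinForm.zero_left] at hef; exact zero_ne_one hef
  refine
    { h_ne_zero := fun h0 ↦ ?_
      lie_e_f := ?_
      lie_h_e_nsmul := by rw [hE, two_smul, ← two_nsmul]
      lie_h_f_nsmul := by rw [hF, neg_smul, two_smul, ← two_nsmul] }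
  · have h := (hyperbolicGrading_apply_eq (K := K) hs he hf hef).1
    rw [← hx, h0, ZeroMemClass.coe_zero, LinearMap.zero_apply, eq_comm, smul_eq_zero] at h
    exact h.elim (two_ne_zero' K) he0
  · apply Subtype.ext
    letI : LieRing (Module.End K V) := LieRing.ofAssociativeRing
    rw [LieSubalgebra.coe_bracket, SetLike.val_smul, lie_smul, Ring.lie_def]
    change (-(2 * (B u u)⁻¹)) • (soElem B u e * soElem B u f - soElem B u f * soElem B u e) = (x : Module.End K V)
    have hcoef : 2 * (B u u)⁻¹ * ((2 : K)⁻¹ * B u u) = 1 := by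
      rw [mul_mul_mul_comm, mul_inv_cancel₀ (two_ne_zero' K), inv_mul_cancel₀ hq, one_mul]
    rw [soElem_e_mul_soElem_f_sub hs he hf hef _ hx hue huf hue huf, soElem_self, zero_sub, neg_smul_neg, smul_smul,
      hcoef, one_smul]

/-- **`𝔤_2` is abelian**: for `a, b ∈ 𝔤_2`, `[a, b] = 0` (`a e = b e = 0`, `a V_0, b V_0 ⊆ Ke`, and on `f`:
`a(bf) = -B(bf, af) e = b(af)` by symmetry of `B`). [cite: LooijengaLunts1997, §2 (2.1)–(2.2) p. 9 L83–L116 ("𝔤_{-2} is abelian"; "[e, 𝔤_2] = 0")] -/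
theorem lie_eq_zero_of_mem_adDegree_two_hyperbolic (hs : ∀ u v : V, B u v = B v u) (he : B e e = 0) (hf : B f f = 0)
    (hef : B e f = 1) (hW : ∀ w, w ∈ W ↔ B w e = 0 ∧ B w f = 0) (x : skewAdjointLieSubalgebra B)
    (hx : (x : Module.End K V) = (2 : K) • ((B.flip f).smulRight e - (B.flip e).smulRight f))
    {a b : skewAdjointLieSubalgebra B} (ha : a ∈ adDegree K x 2) (hb : b ∈ adDegree K x 2) : ⁅a, b⁆ = 0 := by
  obtain ⟨hae, haf, -⟩ := (mem_adDegree_two_iff_apply hs he hf hef hW x hx a).1 ha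
  obtain ⟨hbe, hbf, -⟩ := (mem_adDegree_two_iff_apply hs he hf hef hW x hx b).1 hb
  have hA := fun w (hw : w ∈ W) ↦ apply_eq_of_mem_adDegree_two hs he hf hef hW x hx a ha hw
  have hBv := fun w (hw : w ∈ W) ↦ apply_eq_of_mem_adDegree_two hs he hf hef hW x hx b hb hw
  apply Subtype.ext
  letI : LieRing (Module.End K V) := LieRing.ofAssociativeRing
  rw [LieSubalgebra.coe_bracket, Ring.lie_def, ZeroMemClass.coe_zero]
  refine linearMap_eq_of_eq_on hs he hf hef _ _ ?_ ?_ fun w hwe hwf ↦ ?_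
  · rw [LinearMap.sub_apply, Module.End.mul_apply, Module.End.mul_apply, hae, hbe, map_zero, map_zero, sub_zero,
      LinearMap.zero_apply]
  · rw [LinearMap.sub_apply, Module.End.mul_apply, Module.End.mul_apply, hA _ hbf, hBv _ haf,
      hs ((b : Module.End K V) f) ((a : Module.End K V) f), sub_self, LinearMap.zero_apply]
  · rw [LinearMap.sub_apply, Module.End.mul_apply, Module.End.mul_apply, hA w ((hW w).2 ⟨hwe, hwf⟩),
      hBv w ((hW w).2 ⟨hwe, hwf⟩), map_neg, map_neg, map_smul, map_smul, hae, hbe, smul_zero, smul_zero, neg_zero,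
      sub_zero, LinearMap.zero_apply]

end Triple

/-! ### §13 Anisotropic vectors of `V_0` -/

section Anisotropic

variable [CharZero K] {e f : V} {W : Submodule K V}

/-- **`V_0` contains an anisotropic vector when `dim V ≥ 3`** (`B` non-degenerate): `V_0 = {e,f}^⊥` has dimension
`dim V - 2 ≥ 1` and carries the non-degenerate form `B|_{V_0}`, which is not alternating in characteristic `≠ 2`.
[cite: LooijengaLunts1997, §2 (2.9) p. 10 L96–L100 ("Let V_0 be the orthogonal complement of V_{-2} ⊕ V_2 in V")] -/
theorem exists_anisotropic [FiniteDimensional K V] (hB : B.Nondegenerate) (hs : ∀ u v : V, B u v = B v u)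
    (he : B e e = 0) (hf : B f f = 0) (hef : B e f = 1) (hW : ∀ w, w ∈ W ↔ B w e = 0 ∧ B w f = 0)
    (h3 : 3 ≤ finrank K V) : ∃ u ∈ W, B u u ≠ 0 := by
  have hrefl : B.IsRefl := (LinearMap.BilinForm.isSymm_def.2 hs).isRefl
  have hWeq : W = B.orthogonal (Submodule.span K (Set.range ![e, f])) := by
    ext w; rw [hW, mem_orthogonal_span_pair_iff hs]
  have hPW := LinearMap.BilinForm.isCompl_orthogonal_of_restrict_nondegenerate hrefl
    (restrict_span_pair_nondegenerate hs he hf hef)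
  have hdim : finrank K W + 2 = finrank K V := by
    rw [hWeq, ← finrank_span_pair hs he hf hef, add_comm]
    exact Submodule.finrank_add_eq_of_isCompl hPW
  -- a non-zero vector of `W`
  obtain ⟨w, hwW, hw0⟩ : ∃ w ∈ W, w ≠ 0 := by
    by_contra h
    simp only [not_exists, not_and, not_not] at h
    have : W = ⊥ := (Submodule.eq_bot_iff W).2 h
    rw [this, finrank_bot] at hdim
    omega
  by_cases hww : B w w ≠ 0
  · exact ⟨w, hwW, hww⟩
  rw [not_not] at hww
  -- a partner `w' ∈ W` with `B w w' ≠ 0`, by non-degeneracy of `B|_W`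
  have hnd := restrict_nondegenerate_of_hyperbolic hB hs he hf hef hW
  obtain ⟨w', hw'W, hww'⟩ : ∃ w' ∈ W, B w w' ≠ 0 := by
    by_contra h
    simp only [not_exists, not_and, not_not] at h
    have h0 : (⟨w, hwW⟩ : W) = 0 := hnd.1 ⟨w, hwW⟩ fun y ↦ by
      rw [LinearMap.BilinForm.restrict_apply, LinearMap.domRestrict_apply]
      exact h y y.2
    exact hw0 (congrArg Subtype.val h0)
  by_cases hw'w' : B w' w' ≠ 0
  · exact ⟨w', hw'W, hw'w'⟩
  rw [not_not] at hw'w'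
  refine ⟨w + w', W.add_mem hwW hw'W, ?_⟩
  rw [LinearMap.BilinForm.add_left, LinearMap.BilinForm.add_right, LinearMap.BilinForm.add_right, hww, hw'w',
    hs w' w, zero_add, add_zero, ← two_mul]
  exact mul_ne_zero two_ne_zero hww'

/-- **An isotropic `w` is a difference of two anisotropic vectors** `w + t u₀`, `t u₀` (`u₀` anisotropic): one of
`w + u₀`, `w + 2u₀` is anisotropic. [folklore] -/
private theorem exists_add_smul_anisotropic (hs : ∀ u v : V, B u v = B v u) {u₀ w : V} (hu₀ : B u₀ u₀ ≠ 0) (hw : B w w = 0) :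
    ∃ t : K, (t = 1 ∨ t = 2) ∧ B (w + t • u₀) (w + t • u₀) ≠ 0 := by
  by_contra h
  simp only [not_exists, not_and] at h
  have h1 := not_not.1 (h 1 (Or.inl rfl))
  have h2 := not_not.1 (h 2 (Or.inr rfl))
  simp only [LinearMap.BilinForm.add_left, LinearMap.BilinForm.add_right, LinearMap.BilinForm.smul_left,
    LinearMap.BilinForm.smul_right, hs u₀ w, one_smul, hw] at h1 h2
  have : (2 : K) * B u₀ u₀ = 0 := by linear_combination h2 - 2 * h1
  exact (mul_ne_zero two_ne_zero hu₀) this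

end Anisotropic

/-! ### §14 Generation: `𝔤_2` and the `F_u` generate `𝔰𝔬(V, B)` -/

section Generation

variable [CharZero K] {e f : V} {W : Submodule K V}

/-- **`𝔰𝔬(V, B)` is generated by `𝔤_2` and the image of `f`** (`B` non-degenerate, an anisotropic `u₀ ∈ V_0`): the
Lie subalgebra `S` generated by `𝔤_2 ∪ f(dom f)` contains `h = [E_{u₀}, F_{u₀}]`, every `E_u = r_{u,e}`, every
`F_u ∝ r_{u,f}` (anisotropic `u`, then all `u ∈ V_0` by differences), the rotations
`r_{u',u} = [E_u, F_{u'}] + ½B(u,u')h` of `V_0` and `r_{e,f} = ½h`; by bilinearity every rotation `r_{p,q}`, and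
`𝔰𝔬(V, B)` is spanned by rotations (`T = ½ Σ r_{T bᵢ, bᵢ^∨}`, the tree's `eq_smul_sum_soElem`).
[cite: LooijengaLunts1997, §1 p. 7 L64–L66 ("(ii) 𝔤 is as a Lie algebra generated by 𝔞 and the image of f"); §2 (2.9) p. 10 L94–L103] -/
theorem lieSpan_adDegree_two_union_lefschetzDuals_eq_top [FiniteDimensional K V] (hB : B.Nondegenerate)
    (hs : ∀ u v : V, B u v = B v u) (he : B e e = 0) (hf : B f f = 0) (hef : B e f = 1)
    (hW : ∀ w, w ∈ W ↔ B w e = 0 ∧ B w f = 0) (x : skewAdjointLieSubalgebra B)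
    (hx : (x : Module.End K V) = (2 : K) • ((B.flip f).smulRight e - (B.flip e).smulRight f)) {u₀ : V} (hu₀ : u₀ ∈ W)
    (hq : B u₀ u₀ ≠ 0) :
    LieSubalgebra.lieSpan K (skewAdjointLieSubalgebra B)
        ((adDegree K x 2 : Set (skewAdjointLieSubalgebra B)) ∪ lefschetzDuals K x (adDegree K x 2)) = ⊤ := by
  have hS : B.IsSymm := LinearMap.BilinForm.isSymm_def.2 hs
  set S := LieSubalgebra.lieSpan K (skewAdjointLieSubalgebra B)
    ((adDegree K x 2 : Set (skewAdjointLieSubalgebra B)) ∪ lefschetzDuals K x (adDegree K x 2)) with hSdef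
  -- the predicate "`z ∈ 𝔰𝔬(V, B)` and `z ∈ S`" on endomorphisms
  let P : Module.End K V → Prop := fun z ↦
    ∃ hz : z ∈ skewAdjointLieSubalgebra B, (⟨z, hz⟩ : skewAdjointLieSubalgebra B) ∈ S
  have P_zero : P 0 := ⟨zero_mem _, S.zero_mem⟩
  have P_add : ∀ {a b}, P a → P b → P (a + b) := fun ⟨ha, hSa⟩ ⟨hb, hSb⟩ ↦ ⟨add_mem ha hb, S.add_mem hSa hSb⟩
  have P_smul : ∀ (c : K) {a}, P a → P (c • a) := fun c _ ⟨ha, hSa⟩ ↦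
    ⟨SMulMemClass.smul_mem c ha, S.smul_mem c hSa⟩
  have P_neg : ∀ {a}, P a → P (-a) := fun {a} h ↦ by have := P_smul (-1) h; rwa [neg_one_smul] at this
  have P_sub : ∀ {a b}, P a → P b → P (a - b) := fun ha hb ↦ by rw [sub_eq_add_neg]; exact P_add ha (P_neg hb)
  have P_lie : ∀ {a b}, P a → P b → P (a * b - b * a) := fun ⟨ha, hSa⟩ ⟨hb, hSb⟩ ↦ by
    letI : LieRing (Module.End K V) := LieRing.ofAssociativeRing
    exact ⟨(skewAdjointLieSubalgebra B).lie_mem ha hb, S.lie_mem hSa hSb⟩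
  have P_sum : ∀ {ι : Type _} (t : Finset ι) (g : ι → Module.End K V), (∀ i, P (g i)) → P (∑ i ∈ t, g i) := by
    intro ι t g hg
    classical
    induction t using Finset.induction_on with
    | empty => rw [Finset.sum_empty]; exact P_zero
    | insert a t ha ih => rw [Finset.sum_insert ha]; exact P_add (hg a) ih
  -- the generators: `E_u` (`u ∈ V_0`), the duals `F_u` (`u` anisotropic), and `h`
  have hE_P : ∀ u ∈ W, P (soElem B u e) := fun u hu ↦
    ⟨_, LieSubalgebra.subset_lieSpan (Or.inl (soElem_e_mem_adDegree_two hs he hf hef hW x hx hu))⟩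
  have hF_P' : ∀ u ∈ W, B u u ≠ 0 → P (soElem B u f) := fun u hu hqu ↦ by
    have h : ((-(2 * (B u u)⁻¹)) • ⟨soElem B u f, soElem_mem_skewAdjointLieSubalgebra B hS u f⟩ :
        skewAdjointLieSubalgebra B) ∈ S :=
      LieSubalgebra.subset_lieSpan (Or.inr (mem_lefschetzDuals_iff.2
        ⟨_, soElem_e_mem_adDegree_two hs he hf hef hW x hx hu, isSl2Triple_soElem hs he hf hef hW x hx hu hqu⟩))
    have hc : (-(2 * (B u u)⁻¹) : K) ≠ 0 := neg_ne_zero.2 (mul_ne_zero two_ne_zero (inv_ne_zero hqu))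
    have hP : P ((-(2 * (B u u)⁻¹)) • soElem B u f) := ⟨_, h⟩
    have := P_smul (-(2 * (B u u)⁻¹))⁻¹ hP
    rwa [inv_smul_smul₀ hc] at this
  have hx_P : P (x : Module.End K V) := by
    have t := isSl2Triple_soElem hs he hf hef hW x hx hu₀ hq
    have hEm := soElem_e_mem_adDegree_two hs he hf hef hW x hx hu₀
    have h1 : (⟨soElem B u₀ e, soElem_mem_skewAdjointLieSubalgebra B hS u₀ e⟩ : skewAdjointLieSubalgebra B) ∈ S :=
      LieSubalgebra.subset_lieSpan (Or.inl hEm)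
    have h2 : ((-(2 * (B u₀ u₀)⁻¹)) • ⟨soElem B u₀ f, soElem_mem_skewAdjointLieSubalgebra B hS u₀ f⟩ :
        skewAdjointLieSubalgebra B) ∈ S :=
      LieSubalgebra.subset_lieSpan (Or.inr (mem_lefschetzDuals_iff.2 ⟨_, hEm, t⟩))
    have h := S.lie_mem h1 h2
    rw [t.lie_e_f] at h
    exact ⟨x.2, h⟩
  have hF_P : ∀ w ∈ W, P (soElem B w f) := fun w hw ↦ by
    by_cases hww : B w w ≠ 0
    · exact hF_P' w hw hww
    rw [not_not] at hww
    obtain ⟨t, -, ht⟩ := exists_add_smul_anisotropic hs (u₀ := u₀) (w := w) hq hww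
    have h1 := hF_P' (w + t • u₀) (W.add_mem hw (W.smul_mem t hu₀)) ht
    have h2 := hF_P' u₀ hu₀ hq
    have h := P_sub h1 (P_smul t h2)
    rwa [soElem_add_left, soElem_smul_left, add_sub_cancel_right] at h
  have hWW_P : ∀ u ∈ W, ∀ u' ∈ W, P (soElem B u' u) := fun u hu u' hu' ↦ by
    obtain ⟨hue, huf⟩ := (hW u).1 hu
    obtain ⟨hu'e, hu'f⟩ := (hW u').1 hu'
    have h := P_add (P_lie (hE_P u hu) (hF_P u' hu')) (P_smul ((2 : K)⁻¹ * B u u') hx_P)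
    rwa [soElem_e_mul_soElem_f_sub hs he hf hef _ hx hue huf hu'e hu'f, sub_add_cancel] at h
  have hef_P : P (soElem B e f) := by
    have h := P_smul (2 : K)⁻¹ hx_P
    rwa [← soElem_eq_half_smul hs _ hx] at h
  -- decomposition `p = p₀ + B(p,f) e + B(p,e) f` with `p₀ ∈ V_0`
  have decomp : ∀ p : V, ∃ p₀ ∈ W, p = p₀ + B p f • e + B p e • f := fun p ↦
    ⟨p - B p f • e - B p e • f, (hW _).2 (sub_smul_sub_smul_orthogonal hs he hf hef p), by abel⟩
  have hPe : ∀ p, P (soElem B p e) := fun p ↦ by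
    obtain ⟨p₀, hp₀, hp⟩ := decomp p
    rw [hp, soElem_add_left, soElem_add_left, soElem_smul_left, soElem_smul_left, soElem_self, smul_zero, add_zero,
      soElem_swap B e f]
    exact P_add (hE_P p₀ hp₀) (P_smul _ (P_neg hef_P))
  have hPf : ∀ p, P (soElem B p f) := fun p ↦ by
    obtain ⟨p₀, hp₀, hp⟩ := decomp p
    rw [hp, soElem_add_left, soElem_add_left, soElem_smul_left, soElem_smul_left, soElem_self, smul_zero, add_zero]
    exact P_add (hF_P p₀ hp₀) (P_smul _ hef_P)
  have hPw : ∀ w ∈ W, ∀ p, P (soElem B p w) := fun w hw p ↦ by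
    obtain ⟨p₀, hp₀, hp⟩ := decomp p
    rw [hp, soElem_add_left, soElem_add_left, soElem_smul_left, soElem_smul_left, soElem_swap B w e, soElem_swap B w f]
    exact P_add (P_add (hWW_P w hw p₀ hp₀) (P_smul _ (P_neg (hE_P w hw)))) (P_smul _ (P_neg (hF_P w hw)))
  have hPall : ∀ p q, P (soElem B p q) := fun p q ↦ by
    obtain ⟨q₀, hq₀, hqd⟩ := decomp q
    rw [hqd, soElem_add_right, soElem_add_right, soElem_smul_right, soElem_smul_right]
    exact P_add (P_add (hPw q₀ hq₀ p) (P_smul _ (hPe p))) (P_smul _ (hPf p))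
  -- every `y ∈ 𝔰𝔬(V, B)` is a combination of rotations
  refine eq_top_iff.2 fun y _ ↦ ?_
  have hy : ∀ v w, B ((y : Module.End K V) v) w = -B v ((y : Module.End K V) w) :=
    (mem_skewAdjointLieSubalgebra_iff B _).1 y.2
  have hsum := eq_smul_sum_soElem B hB hS hy (Module.finBasis K V)
  have hPy : P (y : Module.End K V) := by
    rw [hsum]
    exact P_smul _ (P_sum _ _ fun i ↦ hPall _ _)
  obtain ⟨_, hyS⟩ := hPy
  exact hyS

end Generation

/-! ### §15 `(𝔰𝔬(V, B), h_{e,f})` is a Jordan–Lefschetz pair over any field of characteristic `0` — in particular over `ℝ` -/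

section JordanLefschetz

variable [CharZero K] {e f : V} {W : Submodule K V}

/-- **(2.9), orthogonal cases, over ANY field of characteristic `0`**: for `B` symmetric non-degenerate, a hyperbolic pair
`e, f` and an anisotropic `u₀ ∈ V_0`, IF `𝔰𝔬(V, B)` is semisimple then `(𝔰𝔬(V, B), h_{e,f})` is a Jordan–Lefschetz pair
(`𝔤_2` abelian, §12; the `𝔰𝔩₂`-triple `(E_{u₀}, h, F_{u₀})`, §12; generation, §14).  Semisimplicity holds over an
algebraically closed field (row A1-187) and over `ℝ` (row A1-214); the hypothesis isolates it.
[cite: LooijengaLunts1997, §2 (2.9) p. 10 L94–L103, (2.6) p. 10 L20–L29 ("(B_m, B_{m−1}) (m ≥ 2) … (D_m, D_{m−1}) (m ≥ 5)"); §1 p. 7 L54–L78] -/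
theorem isJordanLefschetzPair_hyperbolicGrading_of_isSemisimple [FiniteDimensional K V]
    [LieAlgebra.IsSemisimple K (skewAdjointLieSubalgebra B)] (hB : B.Nondegenerate) (hs : ∀ u v : V, B u v = B v u)
    (he : B e e = 0) (hf : B f f = 0) (hef : B e f = 1) (hW : ∀ w, w ∈ W ↔ B w e = 0 ∧ B w f = 0)
    (x : skewAdjointLieSubalgebra B)
    (hx : (x : Module.End K V) = (2 : K) • ((B.flip f).smulRight e - (B.flip e).smulRight f)) {u₀ : V} (hu₀ : u₀ ∈ W)
    (hq : B u₀ u₀ ≠ 0) : IsJordanLefschetzPair K x := by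
  show IsLefschetzTriple K x (adDegree K x 2)
  exact
    { isSemisimple := ‹_›
      le_adDegree_two := le_rfl
      lie_eq_zero := fun a ha b hb ↦ lie_eq_zero_of_mem_adDegree_two_hyperbolic hs he hf hef hW x hx ha hb
      nonempty_lefschetzDomain := ⟨_, mem_lefschetzDomain_iff.2
        ⟨soElem_e_mem_adDegree_two hs he hf hef hW x hx hu₀, _, isSl2Triple_soElem hs he hf hef hW x hx hu₀ hq⟩⟩
      lieSpan_eq_top := lieSpan_adDegree_two_union_lefschetzDuals_eq_top hB hs he hf hef hW x hx hu₀ hq }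

/-- The same with `dim V ≥ 3` in place of the anisotropic vector (§13). [cite: LooijengaLunts1997, §2 (2.9) p. 10 L94–L103 ("(𝔰𝔬(n), 𝔰𝔬(n−2)) with n ≥ 5 … Let V be a vector space of dimension n")] -/
theorem isJordanLefschetzPair_hyperbolicGrading_of_isSemisimple_of_finrank [FiniteDimensional K V]
    [LieAlgebra.IsSemisimple K (skewAdjointLieSubalgebra B)] (hB : B.Nondegenerate) (hs : ∀ u v : V, B u v = B v u)
    (he : B e e = 0) (hf : B f f = 0) (hef : B e f = 1) (h3 : 3 ≤ finrank K V) (x : skewAdjointLieSubalgebra B)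
    (hx : (x : Module.End K V) = (2 : K) • ((B.flip f).smulRight e - (B.flip e).smulRight f)) :
    IsJordanLefschetzPair K x := by
  have hW : ∀ w, w ∈ B.orthogonal (Submodule.span K (Set.range ![e, f])) ↔ B w e = 0 ∧ B w f = 0 :=
    mem_orthogonal_span_pair_iff hs e f
  obtain ⟨u₀, hu₀, hq⟩ := exists_anisotropic hB hs he hf hef hW h3
  exact isJordanLefschetzPair_hyperbolicGrading_of_isSemisimple hB hs he hf hef hW x hx hu₀ hq

end JordanLefschetz

section Real

variable {V : Type*} [AddCommGroup V] [Module ℝ V] [FiniteDimensional ℝ V] {B : LinearMap.BilinForm ℝ V} {e f : V}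

/-- **The real forms: `(𝔰𝔬(p, q), h_{e,f})` is a Jordan–Lefschetz pair over `ℝ`** for EVERY non-degenerate symmetric
real `B` of any signature with a hyperbolic pair `e, f` and `dim V ≥ 3` (so `p, q ≥ 1`, `p + q ≥ 3`) — e.g.
Looijenga–Lunts' `𝔰𝔬(4, b_2(X) − 2)` on `H²` of a hyperkähler manifold, `𝔰𝔬(3, 19)` for a K3 surface, the Mukai
lattice `U ⊕ …`; semisimplicity from row A1-214 (`RealOrthogonalAlgebraSemisimple.isSemisimple_skewAdjoint`).
[cite: LooijengaLunts1997, §2 (2.9) p. 10 L94–L103; §4 (4.5) p. 19 L23–L26 ("(𝔤_tot(X;ℝ), h) is of Jordan–Lefschetz type of type (B,B) or (D,D) with 𝔤_tot(X;ℝ) isomorphic to 𝔰𝔬(4, b_2(X)−2)")] -/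
theorem isJordanLefschetzPair_hyperbolicGrading_real (hB : B.Nondegenerate) (hs : ∀ u v : V, B u v = B v u)
    (he : B e e = 0) (hf : B f f = 0) (hef : B e f = 1) (h3 : 3 ≤ finrank ℝ V) (x : skewAdjointLieSubalgebra B)
    (hx : (x : Module.End ℝ V) = (2 : ℝ) • ((B.flip f).smulRight e - (B.flip e).smulRight f)) :
    IsJordanLefschetzPair ℝ x := by
  haveI := RealOrthogonalAlgebraSemisimple.isSemisimple_skewAdjoint (LinearMap.BilinForm.isSymm_def.2 hs) hB h3
  exact isJordanLefschetzPair_hyperbolicGrading_of_isSemisimple_of_finrank hB hs he hf hef h3 x hx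

/-- `(𝔰𝔬(V, B), h_{e,f})` is a Lefschetz pair over `ℝ` (`dim V ≥ 3`, any signature with a hyperbolic pair).
[cite: LooijengaLunts1997, §1 p. 7 L77–L78; §4 (4.5) p. 19 L23–L26] -/
theorem isLefschetzPair_hyperbolicGrading_real (hB : B.Nondegenerate) (hs : ∀ u v : V, B u v = B v u)
    (he : B e e = 0) (hf : B f f = 0) (hef : B e f = 1) (h3 : 3 ≤ finrank ℝ V) (x : skewAdjointLieSubalgebra B)
    (hx : (x : Module.End ℝ V) = (2 : ℝ) • ((B.flip f).smulRight e - (B.flip e).smulRight f)) :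
    IsLefschetzPair ℝ x :=
  (isJordanLefschetzPair_hyperbolicGrading_real hB hs he hf hef h3 x hx).isLefschetzPair

/-- Existence form over `ℝ`: a hyperbolic pair in a real quadratic space of dimension `≥ 3` yields a Jordan–Lefschetz
pair `(𝔰𝔬(V, B), h)` with `h = h_{e,f}`. [cite: LooijengaLunts1997, §2 (2.9) p. 10 L94–L103; §4 (4.5) p. 19] -/
theorem exists_isJordanLefschetzPair_real (hB : B.Nondegenerate) (hs : ∀ u v : V, B u v = B v u) (he : B e e = 0)
    (hf : B f f = 0) (hef : B e f = 1) (h3 : 3 ≤ finrank ℝ V) :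
    ∃ x : skewAdjointLieSubalgebra B,
      (x : Module.End ℝ V) = (2 : ℝ) • ((B.flip f).smulRight e - (B.flip e).smulRight f) ∧ IsJordanLefschetzPair ℝ x :=
  ⟨⟨_, hyperbolicGrading_mem_skewAdjointLieSubalgebra hs e f⟩, rfl,
    isJordanLefschetzPair_hyperbolicGrading_real hB hs he hf hef h3 _ rfl⟩

end Real

/-! ### §16 (rider, row A1-224) The unconditional statement over every field of characteristic `0` -/

section AnyField

variable {K : Type*} [Field K] [CharZero K] {V : Type*} [AddCommGroup V] [Module K V] [FiniteDimensional K V]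
  {B : LinearMap.BilinForm K V} {e f : V}

/-- **(2.9), orthogonal cases, UNCONDITIONALLY over EVERY field of characteristic `0`: `(𝔰𝔬(V, B), h_{e,f})` is a
Jordan–Lefschetz pair** for every non-degenerate symmetric `B` with a hyperbolic pair `e, f` and `dim V ≥ 3` — in
particular for the RATIONAL forms (`K = ℚ`: `𝔰𝔬(V_ℚ^* ⊕ V_ℚ)` of a complex torus, `𝔰𝔬(H²(X, ℚ), q_X)` of a hyperkähler
manifold).  §15's semisimplicity hypothesis is row A1-223's `OrthogonalAlgebraSemisimple.isSemisimple` (Bourbaki,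
*Lie* I §6 no. 7 Prop. 9: `𝔰𝔬(V, B)` is semisimple for `n ≥ 3` over any field of characteristic `0`).
[cite: LooijengaLunts1997, §2 (2.9) p. 10 L94–L103 ("(𝔰𝔬(n), 𝔰𝔬(n−2)) with n ≥ 5"), (2.6) p. 10 L20–L29; §3 (3.1)–(3.3) p. 12–13 (𝔤_NS(X) ⊂ 𝔤_tot(X) ≅ 𝔰𝔬(V_ℚ^* ⊕ V_ℚ), "defined over ℚ")] [cite: Bourbaki1989LieGroups13, Ch. I §6 no. 7 Prop. 9] -/
theorem isJordanLefschetzPair_hyperbolicGrading_of_charZero (hB : B.Nondegenerate) (hs : ∀ u v : V, B u v = B v u)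
    (he : B e e = 0) (hf : B f f = 0) (hef : B e f = 1) (h3 : 3 ≤ finrank K V) (x : skewAdjointLieSubalgebra B)
    (hx : (x : Module.End K V) = (2 : K) • ((B.flip f).smulRight e - (B.flip e).smulRight f)) :
    IsJordanLefschetzPair K x := by
  haveI := OrthogonalAlgebraSemisimple.isSemisimple (LinearMap.BilinForm.isSymm_def.2 hs) hB h3
  exact isJordanLefschetzPair_hyperbolicGrading_of_isSemisimple_of_finrank hB hs he hf hef h3 x hx

/-- `(𝔰𝔬(V, B), h_{e,f})` is a Lefschetz pair over every field of characteristic `0` (`dim V ≥ 3`, a hyperbolic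
pair `e, f`). [cite: LooijengaLunts1997, §1 p. 7 L77–L78, §2 (2.9) p. 10 L94–L103] [cite: Bourbaki1989LieGroups13, Ch. I §6 no. 7 Prop. 9] -/
theorem isLefschetzPair_hyperbolicGrading_of_charZero (hB : B.Nondegenerate) (hs : ∀ u v : V, B u v = B v u)
    (he : B e e = 0) (hf : B f f = 0) (hef : B e f = 1) (h3 : 3 ≤ finrank K V) (x : skewAdjointLieSubalgebra B)
    (hx : (x : Module.End K V) = (2 : K) • ((B.flip f).smulRight e - (B.flip e).smulRight f)) :
    IsLefschetzPair K x :=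
  (isJordanLefschetzPair_hyperbolicGrading_of_charZero hB hs he hf hef h3 x hx).isLefschetzPair

/-- Existence form over every field of characteristic `0`: a hyperbolic pair in a non-degenerate quadratic space of
dimension `≥ 3` yields a Jordan–Lefschetz pair `(𝔰𝔬(V, B), h)` with `h = h_{e,f}`.
[cite: LooijengaLunts1997, §2 (2.9) p. 10 L94–L103] [cite: Bourbaki1989LieGroups13, Ch. I §6 no. 7 Prop. 9] -/
theorem exists_isJordanLefschetzPair_of_charZero (hB : B.Nondegenerate) (hs : ∀ u v : V, B u v = B v u) (he : B e e = 0)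
    (hf : B f f = 0) (hef : B e f = 1) (h3 : 3 ≤ finrank K V) :
    ∃ x : skewAdjointLieSubalgebra B,
      (x : Module.End K V) = (2 : K) • ((B.flip f).smulRight e - (B.flip e).smulRight f) ∧ IsJordanLefschetzPair K x :=
  ⟨⟨_, hyperbolicGrading_mem_skewAdjointLieSubalgebra hs e f⟩, rfl,
    isJordanLefschetzPair_hyperbolicGrading_of_charZero hB hs he hf hef h3 _ rfl⟩

end AnyField

end Literature.Algebra.Lie.HyperbolicPlaneGrading
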